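import Summits.CriticalPhenomena.CardyFormulaZ2.Theorems.CardyFlipRussoVoronoiHubFromSmirnovBlackRegionCells

/-!
# Stub `interior_voronoiCell_eq` of line `moebius-exact-delaunay-dilation-ward`
# (crux `VoronoiHubFromSmirnov`, stmt-CriticalPhenomena-6433)

**The interior of a Voronoi cell is cut out by the strict inequalities.**  For a locally finite
set of nuclei `ω ⊆ ℂ` (finite intersection with every compact set) and a nucleus `p`, a point `x`
lies in the interior of the closed Voronoi cell
`voronoiCell ω p = {x | ∀ q ∈ ω, dist x p ≤ dist x q}`
(`Literature.Probability.LatticeModels.voronoiCell`) iff it is strictly closer to `p` than to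
every other nucleus: `interior (voronoiCell ω p) = {x | ∀ q ∈ ω, q ≠ p → dist x p < dist x q}`.
Ties `dist x p = dist x q` therefore only happen on cell boundaries; this is the basic Voronoi
API behind the duality / black-increasing / interface arguments of the line.

Proof.  (⊆) `ci_dist_lt_of_mem_interior`: if a ball around `x` lies in the cell and `q ∈ ω`,
`q ≠ p`, had `dist x q ≤ dist x p`, move from `x` by `s • (q - p)` with `s > 0` small.  The
function `y ↦ dist y q ^ 2 - dist y p ^ 2` is affine with gradient `-2 (q - p)`
(`ci_sq_dist_sub_sq_dist`), so it is `< 0` at the moved point, which is then strictly closer to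
`q` than to `p` — not in the cell, a contradiction.  (⊇) the strict set is contained in the cell
and is open (`ci_isOpen_setOf_dist_lt`): with `B := ω \ {p}` locally finite and nonempty,
`infDist x B` is attained (`brc_exists_infDist_eq_dist`), so the strict set equals
`{x | dist x p < infDist x B}`, an open set (both sides are continuous in `x`); if `B = ∅` it is
all of `ℂ`.  Conclude with `interior_maximal`.

No new definitions; Mathlib only (`interior_maximal`, `mem_interior_iff_mem_nhds`,
`Metric.continuous_infDist_pt`, `isOpen_lt`, `Complex.sq_norm`).
-/

noncomputable section

namespace Summit.CriticalPhenomena.CardyFormulaZ2.Cruxes.VoronoiHubFromSmirnov.MoebiusExactDelaunayDilationWard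

open Set Metric

/-- **Affine identity.** Moving from `x` by `s • (q - p)` changes the affine function
`y ↦ dist y q ^ 2 - dist y p ^ 2` by `-2 s ‖q - p‖ ^ 2`:
`dist y q ^ 2 - dist y p ^ 2 = (dist x q ^ 2 - dist x p ^ 2) - 2 s (dist q p) ^ 2` for
`y = x + s (q - p)`. -/
theorem ci_sq_dist_sub_sq_dist (x p q : ℂ) (s : ℝ) :
    dist (x + (s : ℂ) * (q - p)) q ^ 2 - dist (x + (s : ℂ) * (q - p)) p ^ 2
      = (dist x q ^ 2 - dist x p ^ 2) - 2 * s * dist q p ^ 2 := by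
  simp only [Complex.dist_eq, Complex.sq_norm, Complex.normSq_apply, Complex.sub_re,
    Complex.sub_im, Complex.add_re, Complex.add_im, Complex.mul_re, Complex.mul_im,
    Complex.ofReal_re, Complex.ofReal_im]
  ring

/-- **Interior points satisfy the strict inequalities.** If `x` is an interior point of the
closed Voronoi cell of `p` and `q ∈ ω` is another nucleus, then `dist x p < dist x q`
(no local finiteness needed). -/
theorem ci_dist_lt_of_mem_interior {ω : Set ℂ} {p x : ℂ}
    (hx : x ∈ interior (Literature.Probability.LatticeModels.voronoiCell ω p))
    {q : ℂ} (hq : q ∈ ω) (hqp : q ≠ p) : dist x p < dist x q := by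
  refine lt_of_not_ge fun hle => ?_
  -- a ball around `x` inside the cell
  obtain ⟨ε, hε, hball⟩ := Metric.mem_nhds_iff.1 (mem_interior_iff_mem_nhds.1 hx)
  have hd : 0 < dist q p := dist_pos.2 hqp
  -- step size `s` with `s * dist q p = ε / 2`
  obtain ⟨s, hs, hsd⟩ : ∃ s : ℝ, 0 < s ∧ s * dist q p = ε / 2 :=
    ⟨ε / 2 / dist q p, div_pos (half_pos hε) hd, div_mul_cancel₀ _ hd.ne'⟩
  -- the moved point lies in the ball, hence in the cell
  have hy : x + (s : ℂ) * (q - p) ∈ Literature.Probability.LatticeModels.voronoiCell ω p := by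
    refine hball (mem_ball.2 ?_)
    rw [dist_eq_norm, add_sub_cancel_left, norm_mul, Complex.norm_real, Real.norm_eq_abs,
      abs_of_pos hs, ← Complex.dist_eq, hsd]
    exact half_lt_self hε
  have h1 : dist (x + (s : ℂ) * (q - p)) p ^ 2 ≤ dist (x + (s : ℂ) * (q - p)) q ^ 2 :=
    pow_le_pow_left₀ dist_nonneg (hy q hq) 2
  have h2 := ci_sq_dist_sub_sq_dist x p q s
  have h3 : dist x q ^ 2 ≤ dist x p ^ 2 := pow_le_pow_left₀ dist_nonneg hle 2
  have h4 : 0 < 2 * s * dist q p ^ 2 := by positivity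
  linarith

/-- **The strict set is open.** For `ω` locally finite, `{x | ∀ q ∈ ω, q ≠ p → dist x p < dist x q}`
is open: with `B := ω \ {p}` nonempty, `infDist x B` is attained (`brc_exists_infDist_eq_dist`),
so the set is `{x | dist x p < infDist x B}`; with `B = ∅` it is everything. -/
theorem ci_isOpen_setOf_dist_lt {ω : Set ℂ} (hfin : ∀ K : Set ℂ, IsCompact K → (ω ∩ K).Finite)
    (p : ℂ) : IsOpen {x : ℂ | ∀ q ∈ ω, q ≠ p → dist x p < dist x q} := by
  rcases (ω \ {p}).eq_empty_or_nonempty with hB | hB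
  · -- no other nucleus: the strict set is all of `ℂ`
    have huniv : {x : ℂ | ∀ q ∈ ω, q ≠ p → dist x p < dist x q} = univ := by
      refine eq_univ_of_forall fun x q hq hqp => ?_
      have hmem : q ∈ ω \ {p} := mem_sdiff_singleton.2 ⟨hq, hqp⟩
      rw [hB] at hmem
      exact hmem.elim
    rw [huniv]
    exact isOpen_univ
  · have hBfin : ∀ K : Set ℂ, IsCompact K → ((ω \ {p}) ∩ K).Finite := fun K hK =>
      (hfin K hK).subset (inter_subset_inter_left _ sdiff_subset)
    have heq : {x : ℂ | ∀ q ∈ ω, q ≠ p → dist x p < dist x q}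
        = {x | dist x p < infDist x (ω \ {p})} := by
      ext x
      refine ⟨fun hx => ?_, fun hx q hq hqp => ?_⟩
      · obtain ⟨b₀, hb₀, hb₀eq⟩ := brc_exists_infDist_eq_dist hBfin hB x
        rw [mem_setOf_eq, hb₀eq]
        exact hx b₀ (mem_sdiff_singleton.1 hb₀).1 (mem_sdiff_singleton.1 hb₀).2
      · exact lt_of_lt_of_le hx (infDist_le_dist_of_mem (mem_sdiff_singleton.2 ⟨hq, hqp⟩))
    rw [heq]
    exact isOpen_lt (continuous_id.dist continuous_const) (continuous_infDist_pt _)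

/-- **Interior of a Voronoi cell = strict inequalities.** For a locally finite set of nuclei
`ω ⊆ ℂ` and a nucleus `p`, the interior of the closed Voronoi cell of `p` is the set of points
strictly closer to `p` than to every other nucleus of `ω`; ties only occur on cell boundaries. -/
theorem interior_voronoiCell_eq : ∀ (ω : Set ℂ) (p : ℂ), (∀ K : Set ℂ, IsCompact K → (ω ∩ K).Finite) → interior (Literature.Probability.LatticeModels.voronoiCell ω p) = {x | ∀ q ∈ ω, q ≠ p → dist x p < dist x q} := by
  intro ω p hfin
  refine Subset.antisymm (fun x hx q hq hqp => ci_dist_lt_of_mem_interior hx hq hqp) ?_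
  refine interior_maximal (fun x hx => ?_) (ci_isOpen_setOf_dist_lt hfin p)
  -- the strict set lies in the (closed) cell
  refine Literature.Probability.LatticeModels.mem_voronoiCell_iff.2 fun q hq => ?_
  by_cases hqp : q = p
  · rw [hqp]
  · exact (hx q hq hqp).le

end Summit.CriticalPhenomena.CardyFormulaZ2.Cruxes.VoronoiHubFromSmirnov.MoebiusExactDelaunayDilationWard
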